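import Mathlib
import Literature.ModelTheory.ExponentialFields.DefinabilityParams

/-!
# Ring-definability over `ℤ`: the bottom layer of Gödel's arithmetisation
# (crux stmt-Schanuel-0969 `RigidCore.MinimalCounterexampleInAcl`, line kernel-arithmetic-selection, stub S8)

`--supports stmt-Schanuel-0969`, infrastructure for the registered stub `stub_corankOne_hitSetArithmetical` (S8: the hit
pattern `H_x ⊆ ℤ^m` of a corank-one first failure is `∅`-definable in the RING `ℤ`).  S8 is reached through Gödel's theorem
that recursive relations are arithmetical; this file is its bottom layer, written SEMANTICALLY with Mathlib's `Set.Definable` /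
`Set.DefinableFun` over an arbitrary compatible ring-language structure on `ℤ` (`FirstOrder.Ring.CompatibleRing ℤ`, e.g.
`FirstOrder.Ring.compatibleRingOfRing ℤ`), parameters `∅`:

* combinators: block quantifiers `definable_setOf_existsBlock/forallBlock`, definable maps into `Fin k` built by `Matrix.vecCons`
  (`definableMap_vecCons`), so that an atom `![t₁, …, t_k] ∈ R` with `R ⊆ ℤ^k` definable and `tᵢ` definable functions is
  definable by `Set.Definable.preimage_map`;
* ring terms: `+, ·, −, 0, 1`, every integer constant (`ringDefinableFun_add/mul/neg/sub/intCast`);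
* `ℕ ⊆ ℤ` is `∅`-definable (Lagrange's four-squares theorem, `ringDefinable_nonneg_fin1`), hence `≤`, `<`, divisibility, and the
  quantifiers `∃ n : ℕ`, `∀ n : ℕ` (`ringDefinable_setOf_existsNat/forallNat`);
* the graphs `{(a, b, Nat.pair a b)}`, `{(c, i, Nat.beta c i)} ⊆ ℤ³` of Cantor's pairing and of GÖDEL'S β-FUNCTION are
  `∅`-definable (`ringDefinable_natPairGraph`, `ringDefinable_natBetaGraph`; registered helper stub
  `ringDefinable_natBetaGraph_std`), and Gödel's β-lemma in
  the form used by the representability theorem: every finite sequence is `Nat.beta c` for some code `c` (`exists_beta_eq`,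
  from Mathlib's `Nat.beta_unbeta_coe`).

The representability theorem itself (`Nat.Partrec f →` the graph of `f` is ring-definable) is the companion file
`…HitSetArithmeticalRepresentability.lean`.

References: K. Gödel, *Über formal unentscheidbare Sätze der Principia Mathematica und verwandter Systeme I*, Monatsh. Math.
Phys. 38 (1931) 173–198, Satz VII and the β-function lemma (Hilfssatz 1 of its proof); R. Kaye, *Models of Peano Arithmetic*,
Oxford Logic Guides 15 (1991), §3.1 (Σ₁-definability of recursive functions); J. L. Lagrange (1770), four squares =
Mathlib `Nat.sum_four_squares`.
-/

-- the summit namespace `Summit.Schanuel.Schanuel.…` repeats a component by design (D-0022)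
set_option linter.dupNamespace false

open Set FirstOrder FirstOrder.Language

namespace Summit.Schanuel.Schanuel.Cruxes.MinimalCounterexampleInAcl.KernelArithmeticSelection

open Literature.ModelTheory.ExponentialFields

/-! ## Combinators valid in any structure -/

section General

variable {L : Language} {M : Type*} [L.Structure M] {A : Set M} {α β : Type*}

/-- A block of existential quantifiers: `{v | ∃ u : β → M, P v u}` is definable when `P`, read on `α ⊕ β`-tuples, is
(Mathlib's `Definable.exists_of_finite`, reshaped). [folklore] -/
theorem definable_setOf_existsBlock [Finite β] {P : (α → M) → (β → M) → Prop}
    (h : A.Definable L {w : α ⊕ β → M | P (fun a => w (Sum.inl a)) (fun b => w (Sum.inr b))}) :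
    A.Definable L {v : α → M | ∃ u : β → M, P v u} := by
  have h' := h.exists_of_finite
  refine (congrArg _ ?_).mpr h'
  ext v
  simp only [mem_setOf_eq, Sum.elim_inl, Sum.elim_inr]

/-- A block of universal quantifiers: `{v | ∀ u : β → M, P v u}` is definable when `P`, read on `α ⊕ β`-tuples, is
(Mathlib's `Definable.forall_of_finite`, reshaped). [folklore] -/
theorem definable_setOf_forallBlock [Finite β] {P : (α → M) → (β → M) → Prop}
    (h : A.Definable L {w : α ⊕ β → M | P (fun a => w (Sum.inl a)) (fun b => w (Sum.inr b))}) :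
    A.Definable L {v : α → M | ∀ u : β → M, P v u} := by
  have h' := h.forall_of_finite
  refine (congrArg _ ?_).mpr h'
  ext v
  simp only [mem_setOf_eq, Sum.elim_inl, Sum.elim_inr]

/-- Definable maps into `Fin (k+1)`-tuples are built coordinatewise with `Matrix.vecCons` (so `fun v => ![f₁ v, …, f_k v]` is a
definable map as soon as every `fᵢ` is a definable function). [folklore] -/
theorem definableMap_vecCons {k : ℕ} {f : (α → M) → M} {F : (α → M) → Fin k → M}
    (hf : A.DefinableFun L f) (hF : A.DefinableMap L F) :
    A.DefinableMap L (fun v => Matrix.vecCons (f v) (F v)) := by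
  intro i
  refine Fin.cases ?_ (fun j => ?_) i
  · simpa using hf
  · simpa using hF j

/-- The empty tuple is a definable map. [folklore] -/
theorem definableMap_vecEmpty : A.DefinableMap L (fun _ : α → M => (![] : Fin 0 → M)) :=
  fun i => i.elim0

/-- Reindexing the arguments of a definable function along any map of index types gives a definable function.
[folklore] -/
theorem definableFun_reindex {γ : Type*} {f : (α → M) → M} (hf : A.DefinableFun L f) (σ : α → γ) :
    A.DefinableFun L (fun w : γ → M => f (fun a => w (σ a))) :=
  hf.preimage_comp (Option.map σ)

end General

/-! ## Ring terms over `ℤ` -/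

section RingZ

variable [FirstOrder.Ring.CompatibleRing ℤ] {α : Type*}

/-- Sums of definable functions are definable (the symbol `+` of `Language.ring`). [folklore] -/
theorem ringDefinableFun_add {f g : (α → ℤ) → ℤ} (hf : (∅ : Set ℤ).DefinableFun Language.ring f)
    (hg : (∅ : Set ℤ).DefinableFun Language.ring g) :
    (∅ : Set ℤ).DefinableFun Language.ring (fun v => f v + g v) := by
  have h := (Set.DefinableFun.fun_symbol (L := Language.ring) (M := ℤ) FirstOrder.Ring.addFunc).comp
    (definableMap_vecCons hf (definableMap_vecCons hg definableMap_vecEmpty))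
  simpa [FirstOrder.Ring.CompatibleRing.funMap_add] using h

/-- Products of definable functions are definable (the symbol `·` of `Language.ring`). [folklore] -/
theorem ringDefinableFun_mul {f g : (α → ℤ) → ℤ} (hf : (∅ : Set ℤ).DefinableFun Language.ring f)
    (hg : (∅ : Set ℤ).DefinableFun Language.ring g) :
    (∅ : Set ℤ).DefinableFun Language.ring (fun v => f v * g v) := by
  have h := (Set.DefinableFun.fun_symbol (L := Language.ring) (M := ℤ) FirstOrder.Ring.mulFunc).comp
    (definableMap_vecCons hf (definableMap_vecCons hg definableMap_vecEmpty))
  simpa [FirstOrder.Ring.CompatibleRing.funMap_mul] using h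

/-- Negations of definable functions are definable (the symbol `−` of `Language.ring`). [folklore] -/
theorem ringDefinableFun_neg {f : (α → ℤ) → ℤ} (hf : (∅ : Set ℤ).DefinableFun Language.ring f) :
    (∅ : Set ℤ).DefinableFun Language.ring (fun v => -f v) := by
  have h := (Set.DefinableFun.fun_symbol (L := Language.ring) (M := ℤ) FirstOrder.Ring.negFunc).comp
    (definableMap_vecCons hf definableMap_vecEmpty)
  simpa [FirstOrder.Ring.CompatibleRing.funMap_neg] using h

/-- The constant `0` is a definable function (the symbol `0` of `Language.ring`). [folklore] -/
theorem ringDefinableFun_zero : (∅ : Set ℤ).DefinableFun Language.ring (fun _ : α → ℤ => (0 : ℤ)) := by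
  have h := (Set.DefinableFun.fun_symbol (L := Language.ring) (M := ℤ) FirstOrder.Ring.zeroFunc).comp
    (definableMap_vecEmpty (α := α))
  simpa using h

/-- The constant `1` is a definable function (the symbol `1` of `Language.ring`). [folklore] -/
theorem ringDefinableFun_one : (∅ : Set ℤ).DefinableFun Language.ring (fun _ : α → ℤ => (1 : ℤ)) := by
  have h := (Set.DefinableFun.fun_symbol (L := Language.ring) (M := ℤ) FirstOrder.Ring.oneFunc).comp
    (definableMap_vecEmpty (α := α))
  simpa using h

/-- Differences of definable functions are definable. [folklore] -/
theorem ringDefinableFun_sub {f g : (α → ℤ) → ℤ} (hf : (∅ : Set ℤ).DefinableFun Language.ring f)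
    (hg : (∅ : Set ℤ).DefinableFun Language.ring g) :
    (∅ : Set ℤ).DefinableFun Language.ring (fun v => f v - g v) := by
  simpa [sub_eq_add_neg] using ringDefinableFun_add hf (ringDefinableFun_neg hg)

/-- Every integer constant is an `∅`-definable function (a closed ring term `±(1 + ⋯ + 1)`). [folklore] -/
theorem ringDefinableFun_intCast (n : ℤ) : (∅ : Set ℤ).DefinableFun Language.ring (fun _ : α → ℤ => n) := by
  induction n using Int.induction_on with
  | zero => exact ringDefinableFun_zero
  | succ i ih => exact ringDefinableFun_add ih ringDefinableFun_one
  | pred i ih => exact ringDefinableFun_sub ih ringDefinableFun_one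

/-! ## `ℕ ⊆ ℤ` (Lagrange), order, divisibility, quantifiers over `ℕ` -/

/-- **`ℕ` is `∅`-definable in the ring `ℤ`**: `0 ≤ z ↔ ∃ a b c d, z = a² + b² + c² + d²` (Lagrange's four-squares theorem,
Mathlib `Nat.sum_four_squares`). [folklore] -/
theorem ringDefinable_nonneg_fin1 : (∅ : Set ℤ).Definable Language.ring {v : Fin 1 → ℤ | 0 ≤ v 0} := by
  have h : (∅ : Set ℤ).Definable Language.ring
      {v : Fin 1 → ℤ | ∃ u : Fin 4 → ℤ, v 0 = u 0 * u 0 + u 1 * u 1 + u 2 * u 2 + u 3 * u 3} := by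
    refine definable_setOf_existsBlock (definable_setOf_eq_params (definableFun_proj_params _) ?_)
    exact ringDefinableFun_add (ringDefinableFun_add (ringDefinableFun_add
      (ringDefinableFun_mul (definableFun_proj_params _) (definableFun_proj_params _))
      (ringDefinableFun_mul (definableFun_proj_params _) (definableFun_proj_params _)))
      (ringDefinableFun_mul (definableFun_proj_params _) (definableFun_proj_params _)))
      (ringDefinableFun_mul (definableFun_proj_params _) (definableFun_proj_params _))
  convert h using 1
  ext v
  simp only [mem_setOf_eq]
  constructor
  · intro hv
    obtain ⟨n, hn⟩ := Int.eq_ofNat_of_zero_le hv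
    obtain ⟨a, b, c, d, habcd⟩ := Nat.sum_four_squares n
    refine ⟨![a, b, c, d], ?_⟩
    simp only [Matrix.cons_val_zero, Matrix.cons_val_one, Matrix.cons_val]
    rw [hn, ← habcd]; push_cast; ring
  · rintro ⟨u, hu⟩
    rw [hu]
    exact add_nonneg (add_nonneg (add_nonneg (mul_self_nonneg _) (mul_self_nonneg _)) (mul_self_nonneg _))
      (mul_self_nonneg _)

/-- `{v | 0 ≤ f v}` is definable for a definable function `f`. [folklore] -/
theorem ringDefinable_setOf_nonneg {f : (α → ℤ) → ℤ} (hf : (∅ : Set ℤ).DefinableFun Language.ring f) :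
    (∅ : Set ℤ).Definable Language.ring {v : α → ℤ | 0 ≤ f v} :=
  ringDefinable_nonneg_fin1.preimage_map (definableMap_vecCons hf definableMap_vecEmpty)

/-- `{v | f v ≤ g v}` is definable for definable functions `f`, `g` (`≤` of `ℤ` is ring-definable). [folklore] -/
theorem ringDefinable_setOf_le {f g : (α → ℤ) → ℤ} (hf : (∅ : Set ℤ).DefinableFun Language.ring f)
    (hg : (∅ : Set ℤ).DefinableFun Language.ring g) :
    (∅ : Set ℤ).Definable Language.ring {v : α → ℤ | f v ≤ g v} := by
  have h := ringDefinable_setOf_nonneg (ringDefinableFun_sub hg hf)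
  convert h using 1
  ext v; simp only [mem_setOf_eq, sub_nonneg]

/-- `{v | f v < g v}` is definable for definable functions `f`, `g`. [folklore] -/
theorem ringDefinable_setOf_lt {f g : (α → ℤ) → ℤ} (hf : (∅ : Set ℤ).DefinableFun Language.ring f)
    (hg : (∅ : Set ℤ).DefinableFun Language.ring g) :
    (∅ : Set ℤ).Definable Language.ring {v : α → ℤ | f v < g v} := by
  have h := ringDefinable_setOf_le (ringDefinableFun_add hf ringDefinableFun_one) hg
  convert h using 1
  ext v; simp only [mem_setOf_eq]; omega

/-- Divisibility on `ℤ` is ring-definable: `{v | v 0 ∣ v 1}`. [folklore] -/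
theorem ringDefinable_dvd_fin2 : (∅ : Set ℤ).Definable Language.ring {v : Fin 2 → ℤ | v 0 ∣ v 1} :=
  definable_setOf_exists_params (definable_setOf_eq_params (definableFun_proj_params _)
    (ringDefinableFun_mul (definableFun_proj_params _) (definableFun_proj_params _)))

/-- `{v | f v ∣ g v}` is definable for definable functions `f`, `g`. [folklore] -/
theorem ringDefinable_setOf_dvd {f g : (α → ℤ) → ℤ} (hf : (∅ : Set ℤ).DefinableFun Language.ring f)
    (hg : (∅ : Set ℤ).DefinableFun Language.ring g) :
    (∅ : Set ℤ).Definable Language.ring {v : α → ℤ | f v ∣ g v} :=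
  ringDefinable_dvd_fin2.preimage_map (definableMap_vecCons hf (definableMap_vecCons hg definableMap_vecEmpty))

/-- `{v | f v ≠ g v}` is definable for definable functions `f`, `g`. [folklore] -/
theorem ringDefinable_setOf_ne {f g : (α → ℤ) → ℤ} (hf : (∅ : Set ℤ).DefinableFun Language.ring f)
    (hg : (∅ : Set ℤ).DefinableFun Language.ring g) :
    (∅ : Set ℤ).Definable Language.ring {v : α → ℤ | f v ≠ g v} :=
  (definable_setOf_eq_params hf hg).compl

/-- Existential quantification over `ℕ ⊆ ℤ` of a ring-definable condition is ring-definable. [folklore] -/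
theorem ringDefinable_setOf_existsNat {P : (α → ℤ) → ℤ → Prop}
    (h : (∅ : Set ℤ).Definable Language.ring
      {w : α ⊕ Unit → ℤ | P (fun a => w (Sum.inl a)) (w (Sum.inr ()))}) :
    (∅ : Set ℤ).Definable Language.ring {v : α → ℤ | ∃ n : ℕ, P v n} := by
  have h' : (∅ : Set ℤ).Definable Language.ring {v : α → ℤ | ∃ z : ℤ, 0 ≤ z ∧ P v z} :=
    definable_setOf_exists_params (definable_setOf_and_params
      (ringDefinable_setOf_nonneg (definableFun_proj_params _)) h)
  convert h' using 1
  ext v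
  simp only [mem_setOf_eq]
  constructor
  · rintro ⟨n, hn⟩; exact ⟨n, Int.natCast_nonneg n, hn⟩
  · rintro ⟨z, hz, hP⟩; obtain ⟨n, rfl⟩ := Int.eq_ofNat_of_zero_le hz; exact ⟨n, hP⟩

/-- Universal quantification over `ℕ ⊆ ℤ` of a ring-definable condition is ring-definable. [folklore] -/
theorem ringDefinable_setOf_forallNat {P : (α → ℤ) → ℤ → Prop}
    (h : (∅ : Set ℤ).Definable Language.ring
      {w : α ⊕ Unit → ℤ | P (fun a => w (Sum.inl a)) (w (Sum.inr ()))}) :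
    (∅ : Set ℤ).Definable Language.ring {v : α → ℤ | ∀ n : ℕ, P v n} := by
  have h' : (∅ : Set ℤ).Definable Language.ring {v : α → ℤ | ∀ z : ℤ, 0 ≤ z → P v z} :=
    definable_setOf_forall_params (definable_setOf_imp_params
      (ringDefinable_setOf_nonneg (definableFun_proj_params _)) h)
  convert h' using 1
  ext v
  simp only [mem_setOf_eq]
  constructor
  · intro hv z hz; obtain ⟨n, rfl⟩ := Int.eq_ofNat_of_zero_le hz; exact hv n
  · intro hv n; exact hv n (Int.natCast_nonneg n)

end RingZ

/-! ## Cantor pairing and Gödel's β-function -/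

section Graphs

/-- **The graph `{(a, b, Nat.pair a b) : a, b ∈ ℕ} ⊆ ℤ³` of Cantor's pairing function is ring-definable over `ℤ`**
(arguments read through `Int.toNat` under the guards `0 ≤ a, b`; `Nat.pair a b = if a < b then b² + a else a² + a + b`).
[folklore] -/
theorem ringDefinable_natPairGraph [FirstOrder.Ring.CompatibleRing ℤ] :
    (∅ : Set ℤ).Definable Language.ring
      {v : Fin 3 → ℤ | 0 ≤ v 0 ∧ 0 ≤ v 1 ∧ v 2 = (Nat.pair (v 0).toNat (v 1).toNat : ℤ)} := by
  have h : (∅ : Set ℤ).Definable Language.ring {v : Fin 3 → ℤ | 0 ≤ v 0 ∧ 0 ≤ v 1 ∧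
      ((v 0 < v 1 ∧ v 2 = v 1 * v 1 + v 0) ∨ (v 1 ≤ v 0 ∧ v 2 = v 0 * v 0 + v 0 + v 1))} := by
    refine definable_setOf_and_params (ringDefinable_setOf_nonneg (definableFun_proj_params _))
      (definable_setOf_and_params (ringDefinable_setOf_nonneg (definableFun_proj_params _))
      (definable_setOf_or_params
        (definable_setOf_and_params
          (ringDefinable_setOf_lt (definableFun_proj_params _) (definableFun_proj_params _))
          (definable_setOf_eq_params (definableFun_proj_params _) (ringDefinableFun_add
            (ringDefinableFun_mul (definableFun_proj_params _) (definableFun_proj_params _))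
            (definableFun_proj_params _))))
        (definable_setOf_and_params
          (ringDefinable_setOf_le (definableFun_proj_params _) (definableFun_proj_params _))
          (definable_setOf_eq_params (definableFun_proj_params _) (ringDefinableFun_add (ringDefinableFun_add
            (ringDefinableFun_mul (definableFun_proj_params _) (definableFun_proj_params _))
            (definableFun_proj_params _)) (definableFun_proj_params _))))))
  convert h using 1
  ext v
  simp only [mem_setOf_eq]
  refine and_congr_right fun h0 => and_congr_right fun h1 => ?_
  obtain ⟨a, ha⟩ := Int.eq_ofNat_of_zero_le h0
  obtain ⟨b, hb⟩ := Int.eq_ofNat_of_zero_le h1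
  rw [ha, hb]
  simp only [Int.toNat_natCast, Nat.pair]
  split_ifs with hab
  · push_cast
    constructor
    · intro h2; exact Or.inl ⟨by exact_mod_cast hab, h2⟩
    · rintro (⟨-, h2⟩ | ⟨hba, -⟩)
      · exact h2
      · exfalso; exact absurd (by exact_mod_cast hba : b ≤ a) (not_le.2 hab)
  · push_cast
    constructor
    · intro h2; exact Or.inr ⟨by exact_mod_cast (not_lt.1 hab), h2⟩
    · rintro (⟨hab', -⟩ | ⟨-, h2⟩)
      · exfalso; exact hab (by exact_mod_cast hab')
      · exact h2

/-- Remainders inside `ℤ`: for naturals `a` and `m > 0`, an integer `r` is `a % m` iff `0 ≤ r < m` and `m ∣ a − r`. -/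
theorem eq_natCast_mod_iff (a m : ℕ) (hm : 0 < m) (r : ℤ) :
    r = ((a % m : ℕ) : ℤ) ↔ 0 ≤ r ∧ r < m ∧ (m : ℤ) ∣ (a : ℤ) - r := by
  constructor
  · rintro rfl
    refine ⟨Int.natCast_nonneg _, by exact_mod_cast Nat.mod_lt a hm, (a / m : ℕ), ?_⟩
    have h : ((a % m : ℕ) : ℤ) + (m : ℤ) * ((a / m : ℕ) : ℤ) = a := by exact_mod_cast Nat.mod_add_div a m
    linarith
  · rintro ⟨h0, hlt, hdvd⟩
    have hmod : r ≡ (a : ℤ) [ZMOD (m : ℤ)] := Int.modEq_iff_dvd.2 hdvd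
    have hr : r % (m : ℤ) = r := Int.emod_eq_of_lt h0 hlt
    rw [Int.natCast_mod, ← hmod.eq, hr]

/-- **The graph `{(c, i, Nat.beta c i) : c, i ∈ ℕ} ⊆ ℤ³` of Gödel's β-function is ring-definable over `ℤ`**:
`Nat.beta c i = (unpair c).1 % ((i + 1) · (unpair c).2 + 1)` is expressed through the pairing graph, `<` and divisibility.
[folklore] -/
theorem ringDefinable_natBetaGraph [FirstOrder.Ring.CompatibleRing ℤ] :
    (∅ : Set ℤ).Definable Language.ring
      {v : Fin 3 → ℤ | 0 ≤ v 0 ∧ 0 ≤ v 1 ∧ v 2 = (Nat.beta (v 0).toNat (v 1).toNat : ℤ)} := by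
  have h : (∅ : Set ℤ).Definable Language.ring {v : Fin 3 → ℤ | 0 ≤ v 1 ∧ ∃ u : Fin 2 → ℤ,
      ![u 0, u 1, v 0] ∈ {v : Fin 3 → ℤ | 0 ≤ v 0 ∧ 0 ≤ v 1 ∧ v 2 = (Nat.pair (v 0).toNat (v 1).toNat : ℤ)} ∧
        0 ≤ v 2 ∧ v 2 < (v 1 + 1) * u 1 + 1 ∧ ((v 1 + 1) * u 1 + 1 ∣ u 0 - v 2)} := by
    refine definable_setOf_and_params (ringDefinable_setOf_nonneg (definableFun_proj_params _))
      (definable_setOf_existsBlock (definable_setOf_and_params ?_ (definable_setOf_and_params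
        (ringDefinable_setOf_nonneg (definableFun_proj_params _)) (definable_setOf_and_params
        (ringDefinable_setOf_lt (definableFun_proj_params _) ?_)
        (ringDefinable_setOf_dvd ?_ (ringDefinableFun_sub (definableFun_proj_params _) (definableFun_proj_params _)))))))
    · exact ringDefinable_natPairGraph.preimage_map (definableMap_vecCons (definableFun_proj_params _)
        (definableMap_vecCons (definableFun_proj_params _) (definableMap_vecCons (definableFun_proj_params _)
        definableMap_vecEmpty)))
    · exact ringDefinableFun_add (ringDefinableFun_mul (ringDefinableFun_add (definableFun_proj_params _)
        ringDefinableFun_one) (definableFun_proj_params _)) ringDefinableFun_one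
    · exact ringDefinableFun_add (ringDefinableFun_mul (ringDefinableFun_add (definableFun_proj_params _)
        ringDefinableFun_one) (definableFun_proj_params _)) ringDefinableFun_one
  convert h using 1
  ext v
  simp only [mem_setOf_eq]
  constructor
  · rintro ⟨h0, h1, h2⟩
    obtain ⟨c, hc⟩ := Int.eq_ofNat_of_zero_le h0
    obtain ⟨i, hi⟩ := Int.eq_ofNat_of_zero_le h1
    refine ⟨h1, ![((Nat.unpair c).1 : ℤ), ((Nat.unpair c).2 : ℤ)], ?_⟩
    simp only [Matrix.cons_val_zero, Matrix.cons_val_one, Matrix.cons_val]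
    rw [hc, hi] at h2 ⊢
    simp only [Int.toNat_natCast] at h2
    refine ⟨⟨Int.natCast_nonneg _, Int.natCast_nonneg _, by simp only [Int.toNat_natCast, Nat.pair_unpair]⟩, ?_⟩
    have hm : 0 < (i + 1) * (Nat.unpair c).2 + 1 := Nat.succ_pos _
    have key := (eq_natCast_mod_iff (Nat.unpair c).1 _ hm (v 2)).1 (by rw [h2]; rfl)
    push_cast at key
    exact key
  · rintro ⟨h1, u, hu, h2, hlt, hdvd⟩
    obtain ⟨i, hi⟩ := Int.eq_ofNat_of_zero_le h1
    obtain ⟨ha, hb, hv0⟩ := hu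
    simp only [Matrix.cons_val_zero, Matrix.cons_val_one, Matrix.cons_val] at ha hb hv0
    obtain ⟨a, ha'⟩ := Int.eq_ofNat_of_zero_le ha
    obtain ⟨b, hb'⟩ := Int.eq_ofNat_of_zero_le hb
    rw [hb'] at hlt
    rw [ha', hb'] at hv0 hdvd
    simp only [Int.toNat_natCast] at hv0
    refine ⟨by rw [hv0]; exact Int.natCast_nonneg _, h1, ?_⟩
    rw [hv0, hi]
    simp only [Int.toNat_natCast, Nat.beta, Nat.unpair_pair]
    have hm : 0 < (i + 1) * b + 1 := Nat.succ_pos _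
    refine (eq_natCast_mod_iff a _ hm (v 2)).2 ⟨h2, ?_, ?_⟩
    · push_cast; rw [hi] at hlt; exact hlt
    · push_cast; rw [hi] at hdvd; exact hdvd

/-- **Gödel's β-lemma, sequence form**: every finite sequence `s 0, …, s n` of naturals is `Nat.beta c` restricted to
`[0, n]` for some code `c` (Mathlib's `Nat.beta_unbeta_coe` applied to the list `[s 0, …, s n]`). [folklore] -/
theorem exists_beta_eq (s : ℕ → ℕ) (n : ℕ) : ∃ c : ℕ, ∀ y ≤ n, Nat.beta c y = s y := by
  refine ⟨Nat.unbeta (List.ofFn fun i : Fin (n + 1) => s i), fun y hy => ?_⟩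
  have hlt : y < (List.ofFn fun i : Fin (n + 1) => s i).length := by
    rw [List.length_ofFn]; omega
  have h := Nat.beta_unbeta_coe (List.ofFn fun i : Fin (n + 1) => s i) ⟨y, hlt⟩
  simp only [Fin.getElem_fin, List.getElem_ofFn] at h
  exact h

/-! ## Registered form -/

/-- Registered helper stub `ringDefinable_natBetaGraph_std` of crux stmt-Schanuel-0969 (line kernel-arithmetic-selection, S8):
the graph of Gödel's β-function is `∅`-definable in the ring `ℤ` with Mathlib's standard compatible
structure `FirstOrder.Ring.compatibleRingOfRing ℤ`. [folklore] -/
theorem ringDefinable_natBetaGraph_std : (letI := FirstOrder.Ring.compatibleRingOfRing ℤ; (∅ : Set ℤ).Definable FirstOrder.Language.ring {v : Fin 3 → ℤ | 0 ≤ v 0 ∧ 0 ≤ v 1 ∧ v 2 = (Nat.beta (v 0).toNat (v 1).toNat : ℤ)}) := by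
  letI := FirstOrder.Ring.compatibleRingOfRing ℤ
  exact ringDefinable_natBetaGraph

end Graphs

end Summit.Schanuel.Schanuel.Cruxes.MinimalCounterexampleInAcl.KernelArithmeticSelection
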